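import Mathlib

/-!
# The exponentially convergent trapezoidal rule for periodic analytic functions

**Theorem** [cite: TrefethenWeideman2014, Thm. 4.2] (general period `T > 0`; Trefethen–Weideman state
it for `T = 2π`): let `f` be `T`-periodic, analytic in the strip `|Im z| < a` (`a > 0`) and bounded
there, `|f(z)| ≤ M`.  Then for every `N ≥ 1` the `N`-point trapezoidal (= rectangle) rule
`I_N = (T/N) Σ_{k=0}^{N-1} f(kT/N)` satisfies

  `|I_N - ∫_0^T f(x) dx| ≤ 2 T M / (e^{2π a N / T} - 1)`;

for `T = 2π` this is `4πM/(e^{aN} - 1)` (Trefethen–Weideman (4.16), where the constant `4π` is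
shown to be optimal), and for `T = 1` it is `2M/(e^{2πaN} - 1)`.

The proof is the paper's "Fourier series and aliasing" argument: the Fourier coefficients satisfy
`|c_n| ≤ M e^{-2π a' |n|/T}` for every `a' < a` (shift the segment `[0, T]` to `Im z = ∓a'`; the
vertical sides cancel by periodicity — Mathlib's rectangle form of Cauchy's theorem), the Fourier
series converges absolutely to `f` (Mathlib's `has_pointwise_sum_fourier_series_of_summable`), and
summing it over the nodes kills every coefficient except the multiples of `N` (aliasing), so that
`I_N - I = T Σ_{m ≠ 0} c_{mN}`, a two-sided geometric series.

## References

* L. N. Trefethen, J. A. C. Weideman, *The exponentially convergent trapezoidal rule*, SIAM Review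
  56 (2014) 385–458, Theorem 4.2 and its proof by Fourier series and aliasing, eqs. (4.4)–(4.18).
  [cite: TrefethenWeideman2014, Thm. 4.2]

Locator note (checked 2026-08-20 against the held text, the authors' open-access version of
doi:10.1137/130932132, 76 pp.): there §4 is "Integrals over a periodic interval", the rule is (4.2)
with nodes `θ_k = 2πk/N`, the theorem is Theorem 4.2 with the bound (4.16) and the proof by Fourier
series and aliasing is (4.17)–(4.18), verbatim as quoted above.  That version carries an extra §3
("Physical interpretation: Faraday cage") and numbers the real-line theorem 6.1 (cited in
`TrapezoidalRuleRealLine` under its journal number, Thm. 5.1); the journal's number for the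
periodic-strip theorem may therefore differ from 4.2 and is not asserted here.

AI-produced formalisation (H21 engines group, seat eng-cap-1, 2026-08-20); no facts, no axioms
beyond Mathlib's, no `sorry`.
-/

open Complex Set MeasureTheory Filter Topology

open scoped Real Interval

namespace Literature.Analysis.Quadrature


/-- Sum of the `N`-th roots of unity raised to the `n`-th power (aliasing):
`Σ_{k<N} e^{2πi n k/N} = N` if `N ∣ n`, else `0`. [folklore] -/
private theorem sum_exp_two_pi_mul_div {N : ℕ} (hN : N ≠ 0) (n : ℤ) :
    ∑ k ∈ Finset.range N, cexp (2 * π * I * n * k / N) =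
      if (N : ℤ) ∣ n then (N : ℂ) else 0 := by
  have hNc : (N : ℂ) ≠ 0 := by exact_mod_cast hN
  set ζ := cexp (2 * π * I * n / N) with hζ
  have hpow : ∀ k : ℕ, cexp (2 * π * I * n * k / N) = ζ ^ k := by
    intro k
    rw [hζ, ← Complex.exp_nat_mul]
    congr 1
    ring
  simp_rw [hpow]
  split_ifs with hdvd
  · obtain ⟨m, hm⟩ := hdvd
    have hζ1 : ζ = 1 := by
      rw [hζ, hm, Complex.exp_eq_one_iff]
      refine ⟨m, ?_⟩
      push_cast
      field_simp
    simp [hζ1]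
  · have hζ1 : ζ ≠ 1 := by
      intro h
      rw [hζ, Complex.exp_eq_one_iff] at h
      obtain ⟨m, hm⟩ := h
      apply hdvd
      refine ⟨m, ?_⟩
      have h2 : (2 * π * I : ℂ) ≠ 0 := by simp [Real.pi_ne_zero]
      have : (n : ℂ) = N * m := by
        field_simp at hm
        linear_combination hm
      exact_mod_cast this
    have hζN : ζ ^ N = 1 := by
      rw [hζ, ← Complex.exp_nat_mul, Complex.exp_eq_one_iff]
      exact ⟨n, by field_simp⟩
    rw [geom_sum_eq hζ1, hζN, sub_self, zero_div]



/-- Real part of the exponent `-(2πi n (x + σ i))/T`. [folklore] -/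
private theorem re_exponent (n : ℤ) (x σ T : ℝ) :
    (-(2 * π * I * n * (x + σ * I) / T)).re = 2 * π * n * σ / T := by
  simp [Complex.div_ofReal_re]
  ring

/-- **Fourier coefficients of a periodic function analytic in a strip decay exponentially**
(contour shift; the vertical sides cancel by periodicity): if `f` is `T`-periodic, analytic in
`|Im z| < a` and bounded by `M` there, then for `0 ≤ a' < a` and every `n ∈ ℤ`,
`‖∫_0^T e^{-2πi n x/T} f(x) dx‖ ≤ T M e^{-2π a' |n| / T}`. [folklore] -/
private theorem norm_integral_exp_mul_le {f : ℂ → ℂ} {T a M : ℝ} (hT : 0 < T)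
    (hd : DifferentiableOn ℂ f {z : ℂ | |z.im| < a}) (hper : ∀ z : ℂ, f (z + T) = f z)
    (hM : ∀ z : ℂ, |z.im| < a → ‖f z‖ ≤ M) (n : ℤ) {a' : ℝ} (ha'0 : 0 ≤ a') (ha' : a' < a) :
    ‖∫ x in (0 : ℝ)..T, cexp (-(2 * π * I * n * x / T)) * f x‖ ≤
      T * M * Real.exp (-(2 * π * a' * |(n : ℝ)| / T)) := by
  set g : ℂ → ℂ := fun z => cexp (-(2 * π * I * n * z / T)) * f z with hg
  have hTc : (T : ℂ) ≠ 0 := by exact_mod_cast hT.ne'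
  -- `g` is `T`-periodic
  have hg_per : ∀ z, g (z + T) = g z := by
    intro z
    simp only [hg]
    rw [hper]
    congr 1
    have hsplit : (2 * π * I * n * (z + T) / T : ℂ) = 2 * π * I * n * z / T + 2 * π * I * n := by
      rw [mul_add, add_div, mul_div_assoc (2 * π * I * n) (T : ℂ) T, div_self hTc, mul_one]
    rw [hsplit, show -(2 * π * I * n * z / T + 2 * π * I * n) =
      -(2 * π * I * n * z / T) + ((-n : ℤ) : ℂ) * (2 * π * I) by push_cast; ring]
    rw [Complex.exp_add, Complex.exp_eq_one_iff.mpr ⟨-n, rfl⟩, mul_one]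
  -- `g` is analytic in the strip
  have hg_diff : DifferentiableOn ℂ g {z : ℂ | |z.im| < a} := by
    refine DifferentiableOn.mul (Differentiable.differentiableOn ?_) hd
    exact Complex.differentiable_exp.comp
      (((differentiable_const _).mul differentiable_id).div_const _).neg
  -- shifting the segment `[0, T]` vertically by `σ`, `|σ| < a`, does not change `∫ g`
  have hshift : ∀ σ : ℝ, |σ| < a →
      ∫ x in (0 : ℝ)..T, g x = ∫ x in (0 : ℝ)..T, g (x + σ * I) := by
    intro σ hσ
    have hre : ((T : ℂ) + σ * I).re = T := by simp
    have him : ((T : ℂ) + σ * I).im = σ := by simp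
    have H : DifferentiableOn ℂ g
        ([[(0 : ℂ).re, ((T : ℂ) + σ * I).re]] ×ℂ [[(0 : ℂ).im, ((T : ℂ) + σ * I).im]]) := by
      refine hg_diff.mono fun z hz => ?_
      rw [hre, him, Complex.zero_re, Complex.zero_im, mem_reProdIm] at hz
      have h2 := hz.2
      rw [mem_uIcc] at h2
      show |z.im| < a
      rcases h2 with ⟨h1, h2⟩ | ⟨h1, h2⟩
      · rw [abs_of_nonneg h1]
        exact h2.trans_lt ((le_abs_self σ).trans_lt hσ)
      · rw [abs_of_nonpos h2]
        exact (neg_le_neg h1).trans_lt ((neg_le_abs σ).trans_lt hσ)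
    have key := Complex.integral_boundary_rect_eq_zero_of_differentiableOn g 0 ((T : ℂ) + σ * I) H
    simp only [hre, him, Complex.zero_re, Complex.zero_im, ofReal_zero, zero_mul, add_zero,
      zero_add, smul_eq_mul] at key
    have hv : (∫ y in (0 : ℝ)..σ, g ((T : ℂ) + y * I)) = ∫ y in (0 : ℝ)..σ, g (y * I) :=
      intervalIntegral.integral_congr fun y _ => by rw [add_comm, hg_per]
    rw [hv] at key
    linear_combination key
  -- pointwise bound on the shifted segment
  have hbound : ∀ σ : ℝ, |σ| < a → ∀ x : ℝ,
      ‖g (x + σ * I)‖ ≤ Real.exp (2 * π * n * σ / T) * M := by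
    intro σ hσ x
    simp only [hg]
    rw [norm_mul, Complex.norm_exp, re_exponent]
    refine mul_le_mul_of_nonneg_left (hM _ ?_) (Real.exp_pos _).le
    simpa using hσ
  -- choose the sign of the shift according to the sign of `n`
  have main : ∀ σ : ℝ, |σ| < a → 2 * π * n * σ / T = -(2 * π * a' * |(n : ℝ)| / T) →
      ‖∫ x in (0 : ℝ)..T, g x‖ ≤ T * M * Real.exp (-(2 * π * a' * |(n : ℝ)| / T)) := by
    intro σ hσ hexp
    rw [hshift σ hσ]
    have h := intervalIntegral.norm_integral_le_of_norm_le_const (a := (0 : ℝ)) (b := T)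
      (f := fun x : ℝ => g (x + σ * I)) (C := Real.exp (2 * π * n * σ / T) * M)
      (fun x _ => hbound σ hσ x)
    rw [sub_zero, abs_of_pos hT, hexp] at h
    linarith [h]
  rcases le_or_gt 0 n with hn | hn
  · have habs : |(n : ℝ)| = n := abs_of_nonneg (by exact_mod_cast hn)
    refine main (-a') (by rw [abs_neg, abs_of_nonneg ha'0]; exact ha') ?_
    rw [habs]
    ring
  · have habs : |(n : ℝ)| = -n := abs_of_neg (by exact_mod_cast hn)
    refine main a' (by rw [abs_of_nonneg ha'0]; exact ha') ?_
    rw [habs]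
    ring


/-! ### The theorem -/

/-- **The exponentially convergent trapezoidal rule** (general period).  If `f : ℂ → ℂ` is
`T`-periodic (`T > 0`), analytic in the strip `|Im z| < a` (`a > 0`) and `‖f z‖ ≤ M` there, then for
every `N ≥ 1`,
`‖(T/N) Σ_{k<N} f(kT/N) - ∫_0^T f‖ ≤ 2TM / (e^{2πaN/T} - 1)`.
[cite: TrefethenWeideman2014, Thm. 4.2] -/
theorem norm_trapezoidal_sub_integral_le {f : ℂ → ℂ} {T a M : ℝ} (hT : 0 < T) (ha : 0 < a)
    (hd : DifferentiableOn ℂ f {z : ℂ | |z.im| < a}) (hper : ∀ z : ℂ, f (z + T) = f z)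
    (hM : ∀ z : ℂ, |z.im| < a → ‖f z‖ ≤ M) {N : ℕ} (hN : N ≠ 0) :
    ‖(T / N : ℂ) * ∑ k ∈ Finset.range N, f (k * T / N) - ∫ x in (0 : ℝ)..T, f x‖ ≤
      2 * T * M / (Real.exp (2 * π * a * N / T) - 1) := by
  have hNc : (N : ℂ) ≠ 0 := by exact_mod_cast hN
  have hTc : (T : ℂ) ≠ 0 := by exact_mod_cast hT.ne'
  have hNpos : (0 : ℝ) < N := by exact_mod_cast Nat.pos_of_ne_zero hN
  have hM0 : 0 ≤ M := (norm_nonneg (f 0)).trans (hM 0 (by simpa using ha))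
  -- it suffices to prove the bound with any `a' ∈ (0, a)` in place of `a`
  suffices key : ∀ a' : ℝ, 0 < a' → a' < a →
      ‖(T / N : ℂ) * ∑ k ∈ Finset.range N, f (k * T / N) - ∫ x in (0 : ℝ)..T, f x‖ ≤
        2 * T * M / (Real.exp (2 * π * a' * N / T) - 1) by
    have hden : Real.exp (2 * π * a * N / T) - 1 ≠ 0 := by
      have : 1 < Real.exp (2 * π * a * N / T) := Real.one_lt_exp_iff.mpr (by positivity)
      linarith
    have hcont : ContinuousAt (fun a' : ℝ => 2 * T * M / (Real.exp (2 * π * a' * N / T) - 1)) a :=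
      ContinuousAt.div continuousAt_const (by fun_prop) hden
    refine ge_of_tendsto (hcont.tendsto.mono_left (nhdsWithin_le_nhds (s := Iio a))) ?_
    filter_upwards [Ioo_mem_nhdsLT ha] with a' ha' using key a' ha'.1 ha'.2
  intro a' ha'0 ha'
  -- ### Step 1: `f|_ℝ` as a continuous function on the circle `ℝ / Tℤ`
  haveI : Fact (0 < T) := ⟨hT⟩
  set fR : ℝ → ℂ := fun x => f x with hfR
  have hcontR : Continuous fR :=
    hd.continuousOn.comp_continuous continuous_ofReal fun x => by simpa using ha
  let F : C(AddCircle T, ℂ) :=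
    ⟨AddCircle.liftIco T 0 fR,
      AddCircle.liftIco_continuous (by simpa [hfR] using (hper 0).symm) hcontR.continuousOn⟩
  have hFapply : ∀ x : ℝ, x ∈ Ico 0 T → F (x : AddCircle T) = f x := by
    intro x hx
    show AddCircle.liftIco T 0 fR x = fR x
    exact AddCircle.liftIco_coe_apply (by rwa [zero_add])
  -- ### Step 2: the Fourier coefficients and their exponential decay
  have hcoeff : ∀ n : ℤ, fourierCoeff F n =
      (1 / T : ℝ) • ∫ x in (0 : ℝ)..T, cexp (-(2 * π * I * n * x / T)) * f x := by
    intro n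
    rw [fourierCoeff_eq_intervalIntegral F n 0, zero_add]
    congr 1
    refine intervalIntegral.integral_congr_Ioo_of_le hT.le fun x hx => ?_
    rw [fourier_coe_apply, hFapply x (Ioo_subset_Ico_self hx), smul_eq_mul]
    congr 2
    push_cast
    ring
  have hnorm : ∀ n : ℤ, ‖fourierCoeff F n‖ ≤ M * Real.exp (-(2 * π * a' * |(n : ℝ)| / T)) := by
    intro n
    rw [hcoeff n, norm_smul, Real.norm_of_nonneg (by positivity : (0 : ℝ) ≤ 1 / T)]
    have h := norm_integral_exp_mul_le hT hd hper hM n ha'0.le ha'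
    calc 1 / T * ‖∫ x in (0 : ℝ)..T, cexp (-(2 * π * I * n * x / T)) * f x‖
        ≤ 1 / T * (T * M * Real.exp (-(2 * π * a' * |(n : ℝ)| / T))) :=
          mul_le_mul_of_nonneg_left h (by positivity)
      _ = M * Real.exp (-(2 * π * a' * |(n : ℝ)| / T)) := by field_simp
  -- the majorant as a geometric sequence
  set q : ℝ := Real.exp (-(2 * π * a' / T)) with hq
  have hq0 : 0 < q := Real.exp_pos _
  have hq1 : q < 1 := Real.exp_lt_one_iff.mpr (by
    have : 0 < 2 * π * a' / T := by positivity
    linarith)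
  have hexpq : ∀ k : ℕ, Real.exp (-(2 * π * a' * k / T)) = q ^ k := by
    intro k
    rw [hq, ← Real.exp_nat_mul]
    congr 1
    ring
  have hnorm' : ∀ n : ℤ, ‖fourierCoeff F n‖ ≤ M * q ^ n.natAbs := by
    intro n
    have habs : ((n.natAbs : ℕ) : ℝ) = |(n : ℝ)| := by
      rw [← Int.cast_natCast, Int.natCast_natAbs, Int.cast_abs]
    rw [← hexpq, habs]
    exact hnorm n
  have hsumq : Summable fun n : ℤ => M * q ^ n.natAbs := by
    refine Summable.of_add_one_of_neg_add_one ?_ ?_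
    · have : (fun n : ℕ => M * q ^ ((n : ℤ) + 1).natAbs) = fun n : ℕ => M * q ^ (n + 1) := by
        funext n
        rw [show ((n : ℤ) + 1).natAbs = n + 1 by omega]
      rw [this]
      exact ((summable_geometric_of_lt_one hq0.le hq1).mul_left (M * q)).congr
        fun n => by ring
    · have : (fun n : ℕ => M * q ^ (-((n : ℤ) + 1)).natAbs) = fun n : ℕ => M * q ^ (n + 1) := by
        funext n
        rw [show (-((n : ℤ) + 1)).natAbs = n + 1 by omega]
      rw [this]
      exact ((summable_geometric_of_lt_one hq0.le hq1).mul_left (M * q)).congr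
        fun n => by ring
  have hsumF : Summable (fourierCoeff F) := Summable.of_norm_bounded hsumq hnorm'
  -- ### Step 3: the Fourier series at the nodes, summed over the nodes (aliasing)
  have hnode : ∀ k : ℕ, k < N →
      HasSum (fun n : ℤ => fourierCoeff F n * cexp (2 * π * I * n * k / N)) (f (k * T / N)) := by
    intro k hk
    have hx : ((k : ℝ) * T / N) ∈ Ico 0 T := by
      refine ⟨by positivity, ?_⟩
      rw [div_lt_iff₀ hNpos]
      have : (k : ℝ) + 1 ≤ N := by exact_mod_cast hk
      nlinarith
    have h := has_pointwise_sum_fourier_series_of_summable hsumF ((k : ℝ) * T / N : ℝ)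
    rw [hFapply _ hx] at h
    push_cast at h
    convert h using 2 with n
    rw [fourier_coe_apply, smul_eq_mul]
    congr 2
    push_cast
    field_simp
  have hS : HasSum (fun n : ℤ => fourierCoeff F n * if (N : ℤ) ∣ n then (N : ℂ) else 0)
      (∑ k ∈ Finset.range N, f (k * T / N)) := by
    have h := hasSum_sum fun k hk => hnode k (Finset.mem_range.mp hk)
    have hfun : (fun n : ℤ => ∑ k ∈ Finset.range N, fourierCoeff F n * cexp (2 * π * I * n * k / N)) =
        fun n : ℤ => fourierCoeff F n * if (N : ℤ) ∣ n then (N : ℂ) else 0 := by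
      funext n
      rw [← Finset.mul_sum, sum_exp_two_pi_mul_div hN]
    rwa [hfun] at h
  -- reindex over the multiples of `N`
  set h : ℤ → ℂ := fun m => fourierCoeff F (N * m) with hh
  have hHS : HasSum h ((∑ k ∈ Finset.range N, f (k * T / N)) / N) := by
    have hinj : Function.Injective fun m : ℤ => (N : ℤ) * m :=
      mul_right_injective₀ (by exact_mod_cast hN)
    have hzero : ∀ x : ℤ, x ∉ Set.range (fun m : ℤ => (N : ℤ) * m) →
        (fourierCoeff F x * if (N : ℤ) ∣ x then (N : ℂ) else 0) = 0 := by
      intro x hx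
      have : ¬ (N : ℤ) ∣ x := fun ⟨m, hm⟩ => hx ⟨m, hm.symm⟩
      simp [this]
    have h2 := (hinj.hasSum_iff hzero).mpr hS
    have hfun2 : ((fun n : ℤ => fourierCoeff F n * if (N : ℤ) ∣ n then (N : ℂ) else 0) ∘
        fun m : ℤ => (N : ℤ) * m) = fun m : ℤ => h m * N := by
      funext m
      simp [hh, dvd_mul_right]
    rw [hfun2] at h2
    have h3 := h2.div_const (N : ℂ)
    have hfun3 : (fun m : ℤ => h m * N / N) = h := by
      funext m
      rw [mul_div_cancel_right₀ _ hNc]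
    rwa [hfun3] at h3
  -- ### Step 4: split off `m = 0` and bound the two tails by geometric series
  set r : ℝ := q ^ N with hr
  have hr0 : 0 < r := pow_pos hq0 N
  have hr1 : r < 1 := pow_lt_one₀ hq0.le hq1 hN
  have htail : ∀ m : ℕ,
      ‖h ((m : ℤ) + 1)‖ ≤ M * r ^ (m + 1) ∧ ‖h (-((m : ℤ) + 1))‖ ≤ M * r ^ (m + 1) := by
    intro m
    have e1 : ((N : ℤ) * ((m : ℤ) + 1)).natAbs = N * (m + 1) := by
      rw [Int.natAbs_mul, Int.natAbs_natCast, show ((m : ℤ) + 1).natAbs = m + 1 by omega]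
    have e2 : ((N : ℤ) * -((m : ℤ) + 1)).natAbs = N * (m + 1) := by
      rw [Int.natAbs_mul, Int.natAbs_neg, Int.natAbs_natCast,
        show ((m : ℤ) + 1).natAbs = m + 1 by omega]
    constructor
    · refine (hnorm' _).trans (le_of_eq ?_)
      rw [e1, pow_mul]
    · refine (hnorm' _).trans (le_of_eq ?_)
      rw [e2, pow_mul]
  have hgeo : HasSum (fun m : ℕ => M * r ^ (m + 1)) (M * r / (1 - r)) := by
    have h1 := (hasSum_geometric_of_lt_one hr0.le hr1).mul_left (M * r)
    have e1 : (fun m : ℕ => M * r ^ (m + 1)) = fun m : ℕ => M * r * r ^ m := by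
      funext m
      ring
    rw [e1, div_eq_mul_inv]
    exact h1
  have hA : Summable fun m : ℕ => h ((m : ℤ) + 1) :=
    Summable.of_norm_bounded hgeo.summable fun m => (htail m).1
  have hB : Summable fun m : ℕ => h (-((m : ℤ) + 1)) :=
    Summable.of_norm_bounded hgeo.summable fun m => (htail m).2
  have hAle : ‖∑' m : ℕ, h ((m : ℤ) + 1)‖ ≤ M * r / (1 - r) :=
    tsum_of_norm_bounded hgeo fun m => (htail m).1
  have hBle : ‖∑' m : ℕ, h (-((m : ℤ) + 1))‖ ≤ M * r / (1 - r) :=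
    tsum_of_norm_bounded hgeo fun m => (htail m).2
  have hsplit := HasSum.of_add_one_of_neg_add_one hA.hasSum hB.hasSum
  have hval : (∑ k ∈ Finset.range N, f (k * T / N)) / N =
      (∑' m : ℕ, h ((m : ℤ) + 1)) + h 0 + ∑' m : ℕ, h (-((m : ℤ) + 1)) := hHS.unique hsplit
  -- `h 0 = c_0 = (1/T) ∫ f`
  have hh0 : (T : ℂ) * h 0 = ∫ x in (0 : ℝ)..T, f x := by
    simp only [hh, mul_zero, hcoeff 0]
    rw [Complex.real_smul]
    push_cast
    field_simp
    refine intervalIntegral.integral_congr fun x _ => ?_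
    simp
  -- ### Step 5: assemble
  have hE : (T / N : ℂ) * ∑ k ∈ Finset.range N, f (k * T / N) - ∫ x in (0 : ℝ)..T, f x =
      T * ((∑' m : ℕ, h ((m : ℤ) + 1)) + ∑' m : ℕ, h (-((m : ℤ) + 1))) := by
    rw [← hh0, show (T / N : ℂ) * ∑ k ∈ Finset.range N, f (k * T / N) =
      T * ((∑ k ∈ Finset.range N, f (k * T / N)) / N) by field_simp, hval]
    ring
  have hrat : r / (1 - r) = 1 / (Real.exp (2 * π * a' * N / T) - 1) := by
    have hr' : r = (Real.exp (2 * π * a' * N / T))⁻¹ := by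
      rw [hr, hq, ← Real.exp_nat_mul, ← Real.exp_neg]
      congr 1
      ring
    have hpos : 0 < Real.exp (2 * π * a' * N / T) := Real.exp_pos _
    have hne : Real.exp (2 * π * a' * N / T) - 1 ≠ 0 := by
      have : 1 < Real.exp (2 * π * a' * N / T) := Real.one_lt_exp_iff.mpr (by positivity)
      linarith
    rw [hr']
    field_simp
  rw [hE, norm_mul, Complex.norm_real, Real.norm_of_nonneg hT.le]
  calc T * ‖(∑' m : ℕ, h ((m : ℤ) + 1)) + ∑' m : ℕ, h (-((m : ℤ) + 1))‖
      ≤ T * (M * r / (1 - r) + M * r / (1 - r)) :=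
        mul_le_mul_of_nonneg_left ((norm_add_le _ _).trans (add_le_add hAle hBle)) hT.le
    _ = 2 * T * M * (r / (1 - r)) := by ring
    _ = 2 * T * M / (Real.exp (2 * π * a' * N / T) - 1) := by rw [hrat]; ring

/-! ### The two classical normalisations -/

/-- **Trefethen–Weideman, Theorem 4.2** (period `2π`, verbatim): if `v` is `2π`-periodic, analytic
and `|v(θ)| ≤ M` in the strip `-a < Im θ < a` (`a > 0`), then for every `N ≥ 1` the trapezoidal rule
`I_N = (2π/N) Σ_{k=1}^{N} v(2πk/N)` satisfies `|I_N - ∫_0^{2π} v| ≤ 4πM / (e^{aN} - 1)` (and the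
constant `4π` is best possible, loc. cit.). [cite: TrefethenWeideman2014, Thm. 4.2] -/
theorem norm_trapezoidal_sub_integral_le_two_pi {v : ℂ → ℂ} {a M : ℝ} (ha : 0 < a)
    (hd : DifferentiableOn ℂ v {z : ℂ | |z.im| < a}) (hper : ∀ z : ℂ, v (z + 2 * π) = v z)
    (hM : ∀ z : ℂ, |z.im| < a → ‖v z‖ ≤ M) {N : ℕ} (hN : N ≠ 0) :
    ‖(2 * π / N : ℂ) * ∑ k ∈ Finset.range N, v (2 * π * (k + 1) / N) -
        ∫ θ in (0 : ℝ)..2 * π, v θ‖ ≤ 4 * π * M / (Real.exp (a * N) - 1) := by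
  have hNc : (N : ℂ) ≠ 0 := by exact_mod_cast hN
  have hper' : ∀ z : ℂ, v (z + ((2 * π : ℝ) : ℂ)) = v z := fun z => by
    push_cast
    exact hper z
  have h := norm_trapezoidal_sub_integral_le Real.two_pi_pos ha hd hper' hM hN
  -- the nodes `k = 1, …, N` versus `k = 0, …, N - 1`: the same sum, by periodicity
  have hshift : ∑ k ∈ Finset.range N, v (2 * π * (k + 1) / N) =
      ∑ k ∈ Finset.range N, v (k * ((2 * π : ℝ) : ℂ) / N) := by
    set g : ℕ → ℂ := fun k => v (k * ((2 * π : ℝ) : ℂ) / N) with hg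
    have hgN : g N = g 0 := by
      simp only [hg]
      rw [mul_div_cancel_left₀ _ hNc, Nat.cast_zero, zero_mul, zero_div]
      have h0 := hper' 0
      rw [zero_add] at h0
      exact h0
    have h1 := Finset.sum_range_succ g N
    have h2 := Finset.sum_range_succ' g N
    have hk : ∀ k ∈ Finset.range N, v (2 * π * (k + 1) / N) = g (k + 1) := fun k _ => by
      simp only [hg]
      push_cast
      congr 1
      ring
    rw [Finset.sum_congr rfl hk]
    linear_combination h2.symm.trans h1 + hgN
  rw [hshift]
  have e1 : Real.exp (2 * π * a * N / (2 * π)) = Real.exp (a * N) := by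
    congr 1
    field_simp
  have e2 : 2 * (2 * π) * M / (Real.exp (a * N) - 1) = 4 * π * M / (Real.exp (a * N) - 1) := by
    ring
  rw [e1, e2] at h
  push_cast at h ⊢
  exact h

/-- Period `1` (the form used by validated integrators): if `f` is `1`-periodic, analytic and
`|f| ≤ M` in `|Im z| < a` (`a > 0`), then `|(1/N) Σ_{k<N} f(k/N) - ∫_0^1 f| ≤ 2M/(e^{2πaN} - 1)`.
[cite: TrefethenWeideman2014, Thm. 4.2] -/
theorem norm_trapezoidal_sub_integral_le_one {f : ℂ → ℂ} {a M : ℝ} (ha : 0 < a)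
    (hd : DifferentiableOn ℂ f {z : ℂ | |z.im| < a}) (hper : ∀ z : ℂ, f (z + 1) = f z)
    (hM : ∀ z : ℂ, |z.im| < a → ‖f z‖ ≤ M) {N : ℕ} (hN : N ≠ 0) :
    ‖(1 / N : ℂ) * ∑ k ∈ Finset.range N, f (k / N) - ∫ x in (0 : ℝ)..1, f x‖ ≤
      2 * M / (Real.exp (2 * π * a * N) - 1) := by
  have hper' : ∀ z : ℂ, f (z + ((1 : ℝ) : ℂ)) = f z := fun z => by
    push_cast
    exact hper z
  have h := norm_trapezoidal_sub_integral_le one_pos ha hd hper' hM hN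
  push_cast at h
  simp only [mul_one, div_one] at h
  exact h

end Literature.Analysis.Quadrature
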